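import Summits.CriticalPhenomena.PercolationContinuityZ3.Theorems.PercNearOneGluingNoHeavyLowerTailSahiThreeCopyCellX7aMasks2

/-!
# `NoHeavyLowerTail` (crux stmt-CriticalPhenomena-4575), Sahi programme: `LawGood` for the slot `X7a` at the interior profiles, mask by mask (part 3)

Support file (Sahi cell, seat `prim-sahi-p1`, generation 65; `--supports stmt-CriticalPhenomena-4575`).  Each interior profile `prof7 m` is a relabelling
(by an automorphism of the slot) of a certified class representative (`…CellX7ap*` / class files); COMPUTATIONAL only through `native_decide` on the
invariance of the slot under the relabelling (a `Finset (Pt 7)` identity) and the inherited cell checks. [this work]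
-/

namespace Summit.CriticalPhenomena.PercolationContinuityZ3.Theorems.SahiThreeCopy

open Finset Function Literature.Combinatorics.Sahi2008
open scoped BigOperators

/-- Interior profile `prof7 106` (relabelled from the class representative `prof7 116`). [this work] -/
theorem lawGood_X7am106 : LawGood 7 (prof7 106) (setInd X7aSet) := by
  have h := lawGood_relab (k := 7) ((Equiv.swap (1 : Fin 7) 2).trans (Equiv.swap (3 : Fin 7) 4)) (π := prof7 116) (f := (setInd X7aSet))
    (by rw [setInd_comp_relab, show X7aSet.map (relab ((Equiv.swap (1 : Fin 7) 2).trans (Equiv.swap (3 : Fin 7) 4))).symm.toEmbedding = X7aSet by native_decide]; exact lawGood_X7a1121222)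
  have hπ : prof7 106 = prof7 116 ∘ ((Equiv.swap (1 : Fin 7) 2).trans (Equiv.swap (3 : Fin 7) 4)) := by funext i; fin_cases i <;> rfl
  rw [hπ]; exact h

/-- Interior profile `prof7 107` (relabelled from the class representative `prof7 117`). [this work] -/
theorem lawGood_X7am107 : LawGood 7 (prof7 107) (setInd X7aSet) := by
  have h := lawGood_relab (k := 7) ((Equiv.swap (1 : Fin 7) 2).trans (Equiv.swap (3 : Fin 7) 4)) (π := prof7 117) (f := (setInd X7aSet))
    (by rw [setInd_comp_relab, show X7aSet.map (relab ((Equiv.swap (1 : Fin 7) 2).trans (Equiv.swap (3 : Fin 7) 4))).symm.toEmbedding = X7aSet by native_decide]; exact lawGood_X7a2121222)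
  have hπ : prof7 107 = prof7 117 ∘ ((Equiv.swap (1 : Fin 7) 2).trans (Equiv.swap (3 : Fin 7) 4)) := by funext i; fin_cases i <;> rfl
  rw [hπ]; exact h

/-- Interior profile `prof7 108` (relabelled from the class representative `prof7 116`). [this work] -/
theorem lawGood_X7am108 : LawGood 7 (prof7 108) (setInd X7aSet) := by
  have h := lawGood_relab (k := 7) (Equiv.swap (3 : Fin 7) 4) (π := prof7 116) (f := (setInd X7aSet))
    (by rw [setInd_comp_relab, show X7aSet.map (relab (Equiv.swap (3 : Fin 7) 4)).symm.toEmbedding = X7aSet by native_decide]; exact lawGood_X7a1121222)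
  have hπ : prof7 108 = prof7 116 ∘ (Equiv.swap (3 : Fin 7) 4) := by funext i; fin_cases i <;> rfl
  rw [hπ]; exact h

/-- Interior profile `prof7 109` (relabelled from the class representative `prof7 117`). [this work] -/
theorem lawGood_X7am109 : LawGood 7 (prof7 109) (setInd X7aSet) := by
  have h := lawGood_relab (k := 7) (Equiv.swap (3 : Fin 7) 4) (π := prof7 117) (f := (setInd X7aSet))
    (by rw [setInd_comp_relab, show X7aSet.map (relab (Equiv.swap (3 : Fin 7) 4)).symm.toEmbedding = X7aSet by native_decide]; exact lawGood_X7a2121222)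
  have hπ : prof7 109 = prof7 117 ∘ (Equiv.swap (3 : Fin 7) 4) := by funext i; fin_cases i <;> rfl
  rw [hπ]; exact h

/-- Interior profile `prof7 110` (relabelled from the class representative `prof7 124`). [this work] -/
theorem lawGood_X7am110 : LawGood 7 (prof7 110) (setInd X7aSet) := by
  have h := lawGood_relab (k := 7) (((Equiv.swap (1 : Fin 7) 3).trans (Equiv.swap (2 : Fin 7) 4)).trans (Equiv.swap (1 : Fin 7) 2)) (π := prof7 124) (f := (setInd X7aSet))
    (by rw [setInd_comp_relab, show X7aSet.map (relab (((Equiv.swap (1 : Fin 7) 3).trans (Equiv.swap (2 : Fin 7) 4)).trans (Equiv.swap (1 : Fin 7) 2))).symm.toEmbedding = X7aSet by native_decide]; exact lawGood_X7a1122222)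
  have hπ : prof7 110 = prof7 124 ∘ (((Equiv.swap (1 : Fin 7) 3).trans (Equiv.swap (2 : Fin 7) 4)).trans (Equiv.swap (1 : Fin 7) 2)) := by funext i; fin_cases i <;> rfl
  rw [hπ]; exact h

/-- Interior profile `prof7 111` (relabelled from the class representative `prof7 125`). [this work] -/
theorem lawGood_X7am111 : LawGood 7 (prof7 111) (setInd X7aSet) := by
  have h := lawGood_relab (k := 7) (((Equiv.swap (1 : Fin 7) 3).trans (Equiv.swap (2 : Fin 7) 4)).trans (Equiv.swap (1 : Fin 7) 2)) (π := prof7 125) (f := (setInd X7aSet))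
    (by rw [setInd_comp_relab, show X7aSet.map (relab (((Equiv.swap (1 : Fin 7) 3).trans (Equiv.swap (2 : Fin 7) 4)).trans (Equiv.swap (1 : Fin 7) 2))).symm.toEmbedding = X7aSet by native_decide]; exact lawGood_X7a2122222)
  have hπ : prof7 111 = prof7 125 ∘ (((Equiv.swap (1 : Fin 7) 3).trans (Equiv.swap (2 : Fin 7) 4)).trans (Equiv.swap (1 : Fin 7) 2)) := by funext i; fin_cases i <;> rfl
  rw [hπ]; exact h

/-- Interior profile `prof7 114` (relabelled from the class representative `prof7 116`). [this work] -/
theorem lawGood_X7am114 : LawGood 7 (prof7 114) (setInd X7aSet) := by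
  have h := lawGood_relab (k := 7) (Equiv.swap (1 : Fin 7) 2) (π := prof7 116) (f := (setInd X7aSet))
    (by rw [setInd_comp_relab, show X7aSet.map (relab (Equiv.swap (1 : Fin 7) 2)).symm.toEmbedding = X7aSet by native_decide]; exact lawGood_X7a1121222)
  have hπ : prof7 114 = prof7 116 ∘ (Equiv.swap (1 : Fin 7) 2) := by funext i; fin_cases i <;> rfl
  rw [hπ]; exact h

/-- Interior profile `prof7 115` (relabelled from the class representative `prof7 117`). [this work] -/
theorem lawGood_X7am115 : LawGood 7 (prof7 115) (setInd X7aSet) := by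
  have h := lawGood_relab (k := 7) (Equiv.swap (1 : Fin 7) 2) (π := prof7 117) (f := (setInd X7aSet))
    (by rw [setInd_comp_relab, show X7aSet.map (relab (Equiv.swap (1 : Fin 7) 2)).symm.toEmbedding = X7aSet by native_decide]; exact lawGood_X7a2121222)
  have hπ : prof7 115 = prof7 117 ∘ (Equiv.swap (1 : Fin 7) 2) := by funext i; fin_cases i <;> rfl
  rw [hπ]; exact h

/-- Interior profile `prof7 118` (relabelled from the class representative `prof7 124`). [this work] -/
theorem lawGood_X7am118 : LawGood 7 (prof7 118) (setInd X7aSet) := by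
  have h := lawGood_relab (k := 7) ((Equiv.swap (1 : Fin 7) 3).trans (Equiv.swap (2 : Fin 7) 4)) (π := prof7 124) (f := (setInd X7aSet))
    (by rw [setInd_comp_relab, show X7aSet.map (relab ((Equiv.swap (1 : Fin 7) 3).trans (Equiv.swap (2 : Fin 7) 4))).symm.toEmbedding = X7aSet by native_decide]; exact lawGood_X7a1122222)
  have hπ : prof7 118 = prof7 124 ∘ ((Equiv.swap (1 : Fin 7) 3).trans (Equiv.swap (2 : Fin 7) 4)) := by funext i; fin_cases i <;> rfl
  rw [hπ]; exact h

/-- Interior profile `prof7 119` (relabelled from the class representative `prof7 125`). [this work] -/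
theorem lawGood_X7am119 : LawGood 7 (prof7 119) (setInd X7aSet) := by
  have h := lawGood_relab (k := 7) ((Equiv.swap (1 : Fin 7) 3).trans (Equiv.swap (2 : Fin 7) 4)) (π := prof7 125) (f := (setInd X7aSet))
    (by rw [setInd_comp_relab, show X7aSet.map (relab ((Equiv.swap (1 : Fin 7) 3).trans (Equiv.swap (2 : Fin 7) 4))).symm.toEmbedding = X7aSet by native_decide]; exact lawGood_X7a2122222)
  have hπ : prof7 119 = prof7 125 ∘ ((Equiv.swap (1 : Fin 7) 3).trans (Equiv.swap (2 : Fin 7) 4)) := by funext i; fin_cases i <;> rfl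
  rw [hπ]; exact h

/-- Interior profile `prof7 122` (relabelled from the class representative `prof7 124`). [this work] -/
theorem lawGood_X7am122 : LawGood 7 (prof7 122) (setInd X7aSet) := by
  have h := lawGood_relab (k := 7) (Equiv.swap (1 : Fin 7) 2) (π := prof7 124) (f := (setInd X7aSet))
    (by rw [setInd_comp_relab, show X7aSet.map (relab (Equiv.swap (1 : Fin 7) 2)).symm.toEmbedding = X7aSet by native_decide]; exact lawGood_X7a1122222)
  have hπ : prof7 122 = prof7 124 ∘ (Equiv.swap (1 : Fin 7) 2) := by funext i; fin_cases i <;> rfl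
  rw [hπ]; exact h

/-- Interior profile `prof7 123` (relabelled from the class representative `prof7 125`). [this work] -/
theorem lawGood_X7am123 : LawGood 7 (prof7 123) (setInd X7aSet) := by
  have h := lawGood_relab (k := 7) (Equiv.swap (1 : Fin 7) 2) (π := prof7 125) (f := (setInd X7aSet))
    (by rw [setInd_comp_relab, show X7aSet.map (relab (Equiv.swap (1 : Fin 7) 2)).symm.toEmbedding = X7aSet by native_decide]; exact lawGood_X7a2122222)
  have hπ : prof7 123 = prof7 125 ∘ (Equiv.swap (1 : Fin 7) 2) := by funext i; fin_cases i <;> rfl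
  rw [hπ]; exact h

end Summit.CriticalPhenomena.PercolationContinuityZ3.Theorems.SahiThreeCopy
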